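import Literature.Analysis.OperatorTheory.TwistedKernelTraceFormula
import Mathlib.Analysis.Fourier.FiniteAbelian.PontryaginDuality
import HarnessLib

/-!
# 't Hooft's electric-flux projection of a transfer operator: the flux sectors of a symmetric
# Hilbert–Schmidt kernel under a finite abelian group of measure-preserving symmetries

Topic `Literature/Analysis/OperatorTheory`; sequel of `TwistedKernelTraceFormula.lean` (ONE measure-preserving
twist `T` inserted into the cyclic chain of a bounded symmetric kernel `K` on a finite measure space:
`∫ (κ^{[M+1]} K(·,x))(T x) dμ = Σᵢ λᵢ^M gᵢ(T)`, `gᵢ(T) = ∫ (κbᵢ)(T x) (κbᵢ)(x) dμ`, `|gᵢ(T)| ≤ λᵢ²`, and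
`g_{i₀}(T) = λ_{i₀}²` at the Perron–Frobenius top index when `K > 0` is `T`-invariant).  Here the twists form a
FINITE ABELIAN GROUP `Γ` (written additively) acting by measurable measure-preserving maps `T k`, `T 0 = id`,
`T (k + k') = T k ∘ T k'` — in the time-sliced lattice gauge theory: 't Hooft's central gauge rotations `Ω[k]`,
`k ∈ Z(G)³` ((4.2), (4.4)), realised on a time slice by
`Literature.MathematicalPhysics.QuantumFieldTheory.finSliceTwist` — and the twisted traces `z k (M+2) = Tr(Ω[k] 𝕋^{M+2})`
are resolved into ELECTRIC-FLUX SECTORS labelled by the characters `ψ ∈ Γ̂ = AddChar Γ ℂ` ('t Hooft's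
`e ∈ ℤ_N³`, `ψ_e(k) = e^{2πi(k·e)/N}`, (4.3)–(4.5)):

  `z_ψ(M+2) := |Γ|⁻¹ Σ_k conj ψ(k) · z k (M+2)`  — 't Hooft's `e^{−βF(e)} = Tr P(e) e^{−βH}`,
  `P(e) = N⁻³ Σ_k e^{−2πi(k·e)/N} Ω[k]` ((5.1)–(5.3)); on the lattice (5.4) is the DEFINITION of the left side.

What is PROVED (Mathlib + the companion files; no definitions; everything for a bounded, strongly measurable,
symmetric kernel with an eigenbasis `A bᵢ = λᵢ bᵢ` of its `L²` operator, as in the companion files):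

* `integral_twisted_coeff_sub` — group law: `gᵢ(k − k') = ∫ (κbᵢ)(T_k x) (κbᵢ)(T_{k'} x) dμ`;
* `sum_sum_twisted_coeff_eq_integral_norm_sq`, `twisted_coeff_posSemidef` — **`k ↦ gᵢ(k)` IS A FUNCTION OF
  POSITIVE TYPE on `Γ`**: `Σ_{k,k'} a_k conj(a_{k'}) gᵢ(k − k') = ∫ ‖Σ_k a_k (κbᵢ)(T_k x)‖² dμ ≥ 0` (the Koopman
  representation `k ↦ U_{T_k}` is unitary; no invariance of `K` is needed);
* `fluxCoeff_eq_integral_norm_sq`, `fluxCoeff_nonneg` — the **flux coefficients**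
  `qᵢ(ψ) := |Γ|⁻¹ Σ_k conj ψ(k) gᵢ(k) = |Γ|⁻² ∫ ‖Σ_k conj ψ(k) (κbᵢ)(T_k x)‖² dμ` are REAL and `≥ 0`
  (`= ‖P_ψ κbᵢ‖²`, the weight of the eigenvector in the sector `ψ`; Serre's projection formula);
* `sum_fluxCoeff` (`Σ_ψ qᵢ(ψ) = gᵢ(0) = λᵢ²`), `re_fluxCoeff_le` (`qᵢ(ψ) ≤ λᵢ²`);
* `fluxCoeff_top` — **the vacuum carries no electric flux** ('t Hooft §4): for `K > 0` invariant under every `T_k`,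
  at the top index `λ_{i₀} = ‖A‖ ≠ 0`: `q_{i₀}(ψ) = λ_{i₀}² · [ψ = 0]`;
* `sum_fluxProjection_eq`, `sum_apply_mul_fluxProjection_eq` (any `F : Γ → ℂ`), `sum_fluxSector`,
  `sum_apply_mul_fluxSector`, `sum_sum_sub_eq_card_mul` — completeness `Σ_ψ z_ψ = z 0` and Fourier inversion
  `z k = Σ_ψ ψ(k) z_ψ` of the flux projections (character orthogonality; no spectral input);
* `hasSum_fluxSector` — **the flux-sector trace formula** `z_ψ(M+2) = Σᵢ λᵢ^M qᵢ(ψ)` ((5.3) in the eigenbasis);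
* `fluxSector_nonneg` — for non-negative eigenvalues EVERY FLUX SECTOR IS NON-NEGATIVE AND REAL:
  `0 ≤ z_ψ(M+2)`, `Im z_ψ(M+2) = 0` — 't Hooft's `e^{−βF(e,…)} ≥ 0`, here a theorem of transfer-operator positivity
  for every period `M + 2`, with no reflection (the tree's `MultiTwist.electricFluxWeight_nonneg` is the site-reflection
  proof on the symmetric even torus); `re_fluxSector_le` (`z_ψ ≤ z 0`, i.e. `0 ≤ e^{−βF(e)} ≤ 1` after normalisation);
* `le_re_fluxSector_zero`, `re_fluxSector_le_sub` — the flux-free sector carries the vacuum: `λ_{i₀}^{M+2} ≤ z_0(M+2)` and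
  `z_ψ(2) ≤ z 0 2 − λ_{i₀}²` for `ψ ≠ 0`;
* `re_fluxSector_le_pow_mul` — **the energy of a non-zero electric flux is at least the finite-volume gap**: if
  `λᵢ ≤ Λ` for all `i ≠ i₀` then `z_ψ(M+2) ≤ Λ^M · z_ψ(2)` for every `ψ ≠ 0` (in 't Hooft's words, (5.4) and the line
  after it: «in the limit β → ∞, F becomes the energy of the lowest state with the given flux»; that state is
  orthogonal to the vacuum).

HONEST FRAMING: finite-volume transfer-operator bookkeeping valid for every finite abelian symmetry group of any
positive kernel; the rates (`Λ`, `λ_{i₀}`) are those of ONE finite box.  Nothing here bears on infinite-volume limits,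
duality (6.3), or the light/heavy alternatives of 't Hooft §7; nothing here proves a mass gap.  Related, Summits-side
(not imported): the venture files `Summits/Ventures/YMGap/FlowData/{TorelonEnergy,TubeFluxSectors}.lean` type the
`ℤ₂^k` sector PROJECTIONS of the tube transfer operator and torelon energies by operator norms; the present file is the
trace-level (partition-function) statement for an arbitrary finite abelian `Γ`, with positivity, the vacuum sector and
the gap bound, over the kernel vocabulary of `TwistedKernelTraceFormula.lean`.

References: G. 't Hooft, Nucl. Phys. B 153 (1979) 141, §4 (4.2)–(4.5), §5 (5.1)–(5.4) (reprint: C. Rebbi (ed.),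
*Lattice Gauge Theories and Monte Carlo Simulations*, World Scientific 1983, pp. 552–553); J.-P. Serre, *Linear
Representations of Finite Groups* (1977) §2.3 Thm 3, §2.6 Thm 8 (ii) (`p_i = (n_i/g) Σ_t χ_i(t)^* ρ_t`); M. Reed,
B. Simon, *Methods of Modern Mathematical Physics* I (1980) Thm VI.22–23, IV (1978) Thm XIII.43–44; P. van Baal,
Commun. Math. Phys. 85 (1982) 529 (Hamiltonian treatment of twisted boxes; cited, not used).
-/

noncomputable section

namespace Literature.Analysis.OperatorTheory

open MeasureTheory Filter Set Function Finset
open scoped RealInnerProductSpace ENNReal ComplexConjugate BigOperators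

/-! ### Character bookkeeping on a finite abelian group: completeness and inversion of the flux projections -/

section Fourier

variable {Γ : Type*} [AddCommGroup Γ] [Fintype Γ]

/-- **Completeness of the flux projections**: `Σ_ψ |Γ|⁻¹ Σ_k conj ψ(k) F(k) = F(0)` for every `F : Γ → ℂ`
(`Σ_e P(e) = 1`; character orthogonality `Σ_ψ ψ(k) = |Γ|·[k = 0]`).
[cite: tHooft1979Flux, §5 (5.2)] [cite: Serre1977, §2.6 Thm 8 (ii)] -/
theorem sum_fluxProjection_eq (F : Γ → ℂ) :
    ∑ ψ : AddChar Γ ℂ, (Fintype.card Γ : ℂ)⁻¹ * ∑ k, conj (ψ k) * F k = F 0 := by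
  classical
  have hcard : (Fintype.card Γ : ℂ) ≠ 0 := Nat.cast_ne_zero.2 Fintype.card_ne_zero
  have hswap : ∑ ψ : AddChar Γ ℂ, ∑ k, conj (ψ k) * F k = ∑ k, (∑ ψ : AddChar Γ ℂ, ψ (-k)) * F k := by
    rw [Finset.sum_comm]
    refine Finset.sum_congr rfl fun k _ => ?_
    rw [Finset.sum_mul]
    refine Finset.sum_congr rfl fun ψ _ => ?_
    rw [AddChar.map_neg_eq_conj]
  have hinner : ∑ k, (∑ ψ : AddChar Γ ℂ, ψ (-k)) * F k = (Fintype.card Γ : ℂ) * F 0 := by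
    rw [Finset.sum_eq_single (0 : Γ)]
    · rw [neg_zero, AddChar.sum_apply_eq_ite, if_pos rfl]
    · intro k _ hk
      rw [AddChar.sum_apply_eq_ite, if_neg (neg_ne_zero.2 hk), zero_mul]
    · intro h
      exact absurd (Finset.mem_univ _) h
  rw [← Finset.mul_sum, hswap, hinner, ← mul_assoc, inv_mul_cancel₀ hcard, one_mul]

/-- **Fourier inversion of the flux projections**: `Σ_ψ ψ(k₀) · (|Γ|⁻¹ Σ_k conj ψ(k) F(k)) = F(k₀)`
('t Hooft's `Tr Ω[k] e^{−βH} = Σ_e e^{2πi(k·e)/N} e^{−βF(e)}`, inverting (5.3)).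
[cite: tHooft1979Flux, §5 (5.2)–(5.3)] [cite: Serre1977, §2.3 Thm 3 and §2.6 Thm 8 (ii)] -/
theorem sum_apply_mul_fluxProjection_eq (F : Γ → ℂ) (k₀ : Γ) :
    ∑ ψ : AddChar Γ ℂ, ψ k₀ * ((Fintype.card Γ : ℂ)⁻¹ * ∑ k, conj (ψ k) * F k) = F k₀ := by
  classical
  have hcard : (Fintype.card Γ : ℂ) ≠ 0 := Nat.cast_ne_zero.2 Fintype.card_ne_zero
  have hterm : ∀ ψ : AddChar Γ ℂ, ψ k₀ * ((Fintype.card Γ : ℂ)⁻¹ * ∑ k, conj (ψ k) * F k) =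
      (Fintype.card Γ : ℂ)⁻¹ * ∑ k, ψ (k₀ - k) * F k := fun ψ => by
    rw [mul_left_comm, Finset.mul_sum]
    congr 1
    refine Finset.sum_congr rfl fun k _ => ?_
    rw [← mul_assoc, ← AddChar.map_neg_eq_conj, ← AddChar.map_add_eq_mul, ← sub_eq_add_neg]
  simp_rw [hterm]
  have hswap : ∑ ψ : AddChar Γ ℂ, ∑ k, ψ (k₀ - k) * F k = ∑ k, (∑ ψ : AddChar Γ ℂ, ψ (k₀ - k)) * F k := by
    rw [Finset.sum_comm]
    refine Finset.sum_congr rfl fun k _ => ?_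
    rw [Finset.sum_mul]
  have hinner : ∑ k, (∑ ψ : AddChar Γ ℂ, ψ (k₀ - k)) * F k = (Fintype.card Γ : ℂ) * F k₀ := by
    rw [Finset.sum_eq_single k₀]
    · rw [sub_self, AddChar.sum_apply_eq_ite, if_pos rfl]
    · intro k _ hk
      rw [AddChar.sum_apply_eq_ite, if_neg (sub_ne_zero.2 (Ne.symm hk)), zero_mul]
    · intro h
      exact absurd (Finset.mem_univ _) h
  rw [← Finset.mul_sum, hswap, hinner, ← mul_assoc, inv_mul_cancel₀ hcard, one_mul]

/-- The double sum of a function of the difference: `Σ_k Σ_{k'} F(k − k') = |Γ| · Σ_d F(d)`.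
[cite: Serre1977, §2.3 Thm 3] -/
theorem sum_sum_sub_eq_card_mul (F : Γ → ℂ) :
    ∑ k, ∑ k', F (k - k') = (Fintype.card Γ : ℂ) * ∑ d, F d := by
  have h : ∀ k : Γ, ∑ k', F (k - k') = ∑ d, F d := fun k =>
    Fintype.sum_equiv (Equiv.subLeft k) _ _ fun k' => rfl
  simp_rw [h]
  rw [Finset.sum_const, Finset.card_univ, nsmul_eq_mul]

end Fourier

/-! ### The flux sectors of a symmetric kernel under a finite abelian group of measure-preserving twists -/

section Kernel

variable {X : Type*} [MeasurableSpace X] {μ : Measure X} [IsFiniteMeasure μ]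
  {K : X → X → ℝ} {C : ℝ} {A : Lp ℝ 2 μ →L[ℝ] Lp ℝ 2 μ} {ι : Type*}
  {b : HilbertBasis ι ℝ (Lp ℝ 2 μ)} {lam : ι → ℝ}
  {Γ : Type*} [AddCommGroup Γ] [Fintype Γ] {T : Γ → X → X}

omit [Fintype Γ] in
/-- **Group law for the twisted coefficients**: for an additive action by measure-preserving maps
(`T 0 = id`, `T (k + k') = T k ∘ T k'`), `gᵢ(k − k') = ∫ (κbᵢ)(T_k x) (κbᵢ)(T_{k'} x) dμ` — substitute `x = T_{k'} y`
('t Hooft's group law `Ω[k₁]Ω[k₂] = Ω[k₁ + k₂]`, (4.4)). [cite: tHooft1979Flux, §4 (4.4)] -/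
theorem integral_twisted_coeff_sub (hK : StronglyMeasurable (uncurry K))
    (hT : ∀ k, MeasurePreserving (T k) μ μ) (hT0 : T 0 = id)
    (hTadd : ∀ k k' x, T (k + k') x = T k (T k' x)) (i : ι) (k k' : Γ) :
    ∫ x, (∫ z, K (T (k - k') x) z * b i z ∂μ) * (∫ z, K x z * b i z ∂μ) ∂μ =
      ∫ x, (∫ z, K (T k x) z * b i z ∂μ) * (∫ z, K (T k' x) z * b i z ∂μ) ∂μ := by
  set c : X → ℝ := fun x => ∫ z, K x z * b i z ∂μ with hc
  have hcm : Measurable c := measurable_integral_kernel_mul_basis hK b i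
  have hTk : ∀ x, T k x = T (k - k') (T k' x) := fun x => by
    rw [← hTadd, sub_add_cancel]
  have h0 : ∀ x, c x = c (T 0 x) := fun x => by rw [hT0, id_eq]
  show ∫ x, c (T (k - k') x) * c x ∂μ = ∫ x, c (T k x) * c (T k' x) ∂μ
  have h1 : (fun x => c (T k x) * c (T k' x)) = fun x => (fun y => c (T (k - k') y) * c y) (T k' x) := by
    funext x
    rw [hTk x]
  rw [h1]
  have h2 := integral_map (μ := μ) (hT k').measurable.aemeasurable (f := fun y => c (T (k - k') y) * c y)
    (((hcm.comp (hT (k - k')).measurable).mul hcm).aestronglyMeasurable)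
  rw [(hT k').map_eq] at h2
  exact h2

omit [AddCommGroup Γ] [Fintype Γ] in
/-- The twisted sections `x ↦ (κbᵢ)(T_k x)` are bounded and measurable, so their products are integrable (finite
measure). [cite: ReedSimonI1980, Thm. VI.22–23] -/
theorem integrable_twisted_section_mul (hK : StronglyMeasurable (uncurry K)) (hC : ∀ x y, ‖K x y‖ ≤ C)
    (hT : ∀ k, MeasurePreserving (T k) μ μ) (i : ι) (k k' : Γ) :
    Integrable (fun x => (∫ z, K (T k x) z * b i z ∂μ) * (∫ z, K (T k' x) z * b i z ∂μ)) μ := by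
  set c : X → ℝ := fun x => ∫ z, K x z * b i z ∂μ with hc
  have hcm : Measurable c := measurable_integral_kernel_mul_basis hK b i
  have hC' : ∀ x y, ‖K x y‖ ≤ |C| := fun x y => (hC x y).trans (le_abs_self C)
  have hcb : ∀ y, |c y| ≤ |C| * Real.sqrt (μ.real univ) * ‖(b i : Lp ℝ 2 μ)‖ := fun y =>
    abs_integral_kernel_mul_le hC' (abs_nonneg C) (b i) y
  set B : ℝ := |C| * Real.sqrt (μ.real univ) * ‖(b i : Lp ℝ 2 μ)‖ with hB
  have hB0 : 0 ≤ B := by positivity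
  refine Integrable.of_bound (((hcm.comp (hT k).measurable).mul (hcm.comp (hT k').measurable)).aestronglyMeasurable)
    (B * B) (Eventually.of_forall fun x => ?_)
  rw [Real.norm_eq_abs, abs_mul]
  exact mul_le_mul (hcb _) (hcb _) (abs_nonneg _) hB0

/-- **The twisted coefficients are a function of positive type on `Γ`.**  For every `a : Γ → ℂ`,
`Σ_k Σ_{k'} a_k conj(a_{k'}) gᵢ(k − k') = ∫ ‖Σ_k a_k (κbᵢ)(T_k x)‖² dμ` — the Koopman operators `U_{T_k}` form a
unitary representation of `Γ` on `L²(μ)`, and `gᵢ(k) = ⟨U_{T_k} κbᵢ, κbᵢ⟩` is its diagonal coefficient at `κbᵢ`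
('t Hooft's `⟨n|Ω[k]|n⟩`, (4.3) and (5.3)).  No invariance of `K` is needed.
[cite: tHooft1979Flux, §4 (4.3)–(4.4)] [cite: Serre1977, §2.6 Thm 8 (ii)] -/
theorem sum_sum_twisted_coeff_eq_integral_norm_sq (hK : StronglyMeasurable (uncurry K))
    (hC : ∀ x y, ‖K x y‖ ≤ C) (hT : ∀ k, MeasurePreserving (T k) μ μ) (hT0 : T 0 = id)
    (hTadd : ∀ k k' x, T (k + k') x = T k (T k' x)) (i : ι) (a : Γ → ℂ) :
    ∑ k, ∑ k', a k * conj (a k') *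
        ((∫ x, (∫ z, K (T (k - k') x) z * b i z ∂μ) * (∫ z, K x z * b i z ∂μ) ∂μ : ℝ) : ℂ) =
      ((∫ x, ‖∑ k, a k * ((∫ z, K (T k x) z * b i z ∂μ : ℝ) : ℂ)‖ ^ 2 ∂μ : ℝ) : ℂ) := by
  set c : X → ℝ := fun x => ∫ z, K x z * b i z ∂μ with hc
  show ∑ k, ∑ k', a k * conj (a k') * ((∫ x, c (T (k - k') x) * c x ∂μ : ℝ) : ℂ) =
      ((∫ x, ‖∑ k, a k * (c (T k x) : ℂ)‖ ^ 2 ∂μ : ℝ) : ℂ)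
  have hint : ∀ k k', Integrable (fun x => c (T k x) * c (T k' x)) μ := fun k k' =>
    integrable_twisted_section_mul hK hC hT i k k'
  -- (1) the group law, and the constants go under the integral sign
  have h1 : ∀ k k', a k * conj (a k') * ((∫ x, c (T (k - k') x) * c x ∂μ : ℝ) : ℂ) =
      ∫ x, a k * conj (a k') * ((c (T k x) * c (T k' x) : ℝ) : ℂ) ∂μ := fun k k' => by
    have hsub : (∫ x, c (T (k - k') x) * c x ∂μ : ℝ) = ∫ x, c (T k x) * c (T k' x) ∂μ :=
      integral_twisted_coeff_sub hK hT hT0 hTadd i k k'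
    rw [hsub, integral_const_mul, integral_complex_ofReal]
  simp_rw [h1]
  -- (2) the finite double sum goes under the integral sign
  have hintC : ∀ k k', Integrable (fun x => a k * conj (a k') * ((c (T k x) * c (T k' x) : ℝ) : ℂ)) μ :=
    fun k k' => ((hint k k').ofReal (𝕜 := ℂ)).const_mul (a k * conj (a k'))
  have h2 : ∑ k, ∑ k', ∫ x, a k * conj (a k') * ((c (T k x) * c (T k' x) : ℝ) : ℂ) ∂μ =
      ∫ x, ∑ k, ∑ k', a k * conj (a k') * ((c (T k x) * c (T k' x) : ℝ) : ℂ) ∂μ := by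
    rw [integral_finsetSum _ fun k _ => integrable_finsetSum _ fun k' _ => hintC k k']
    refine Finset.sum_congr rfl fun k _ => ?_
    rw [integral_finsetSum _ fun k' _ => hintC k k']
  rw [h2]
  -- (3) pointwise, the double sum is `‖S x‖²` for `S x = Σ_k a_k (κbᵢ)(T_k x)`
  have h3 : ∀ x, ∑ k, ∑ k', a k * conj (a k') * ((c (T k x) * c (T k' x) : ℝ) : ℂ) =
      ((‖∑ k, a k * (c (T k x) : ℂ)‖ ^ 2 : ℝ) : ℂ) := fun x => by
    rw [Complex.ofReal_pow, ← Complex.mul_conj', map_sum, Finset.sum_mul_sum]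
    refine Finset.sum_congr rfl fun k _ => Finset.sum_congr rfl fun k' _ => ?_
    rw [map_mul, Complex.conj_ofReal]
    push_cast
    ring
  simp_rw [h3]
  exact integral_complex_ofReal

/-- Positive type, stated as an inequality: `0 ≤ Re Σ_{k,k'} a_k conj(a_{k'}) gᵢ(k − k')` and the imaginary part
vanishes. [cite: tHooft1979Flux, §4 (4.3)–(4.4)] [cite: Serre1977, §2.6 Thm 8 (ii)] -/
theorem twisted_coeff_posSemidef (hK : StronglyMeasurable (uncurry K))
    (hC : ∀ x y, ‖K x y‖ ≤ C) (hT : ∀ k, MeasurePreserving (T k) μ μ) (hT0 : T 0 = id)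
    (hTadd : ∀ k k' x, T (k + k') x = T k (T k' x)) (i : ι) (a : Γ → ℂ) :
    0 ≤ (∑ k, ∑ k', a k * conj (a k') *
        ((∫ x, (∫ z, K (T (k - k') x) z * b i z ∂μ) * (∫ z, K x z * b i z ∂μ) ∂μ : ℝ) : ℂ)).re ∧
      (∑ k, ∑ k', a k * conj (a k') *
        ((∫ x, (∫ z, K (T (k - k') x) z * b i z ∂μ) * (∫ z, K x z * b i z ∂μ) ∂μ : ℝ) : ℂ)).im = 0 := by
  rw [sum_sum_twisted_coeff_eq_integral_norm_sq hK hC hT hT0 hTadd i a, Complex.ofReal_re, Complex.ofReal_im]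
  exact ⟨integral_nonneg fun x => sq_nonneg _, rfl⟩

/-- **The flux coefficients as squared norms of projections.**  For a character `ψ ∈ Γ̂`,
`qᵢ(ψ) := |Γ|⁻¹ Σ_k conj ψ(k) gᵢ(k) = |Γ|⁻² ∫ ‖Σ_k conj ψ(k) (κbᵢ)(T_k x)‖² dμ = ‖P_ψ κbᵢ‖²`, where
`P_ψ = |Γ|⁻¹ Σ_k conj ψ(k) U_{T_k}` is the projection onto the `ψ`-isotypic component ('t Hooft's `P(e)`, (5.2);
Serre's `p_i = (n_i/g) Σ_t χ_i(t)^* ρ_t`). [cite: tHooft1979Flux, §5 (5.2)] [cite: Serre1977, §2.6 Thm 8 (ii)] -/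
theorem fluxCoeff_eq_integral_norm_sq (hK : StronglyMeasurable (uncurry K))
    (hC : ∀ x y, ‖K x y‖ ≤ C) (hT : ∀ k, MeasurePreserving (T k) μ μ) (hT0 : T 0 = id)
    (hTadd : ∀ k k' x, T (k + k') x = T k (T k' x)) (i : ι) (ψ : AddChar Γ ℂ) :
    (Fintype.card Γ : ℂ)⁻¹ * ∑ k, conj (ψ k) *
        ((∫ x, (∫ z, K (T k x) z * b i z ∂μ) * (∫ z, K x z * b i z ∂μ) ∂μ : ℝ) : ℂ) =
      (((Fintype.card Γ : ℝ)⁻¹ ^ 2 *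
        ∫ x, ‖∑ k, conj (ψ k) * ((∫ z, K (T k x) z * b i z ∂μ : ℝ) : ℂ)‖ ^ 2 ∂μ : ℝ) : ℂ) := by
  set c : X → ℝ := fun x => ∫ z, K x z * b i z ∂μ with hc
  show (Fintype.card Γ : ℂ)⁻¹ * ∑ k, conj (ψ k) * ((∫ x, c (T k x) * c x ∂μ : ℝ) : ℂ) =
      (((Fintype.card Γ : ℝ)⁻¹ ^ 2 * ∫ x, ‖∑ k, conj (ψ k) * (c (T k x) : ℂ)‖ ^ 2 ∂μ : ℝ) : ℂ)
  have hcard : (Fintype.card Γ : ℂ) ≠ 0 := Nat.cast_ne_zero.2 Fintype.card_ne_zero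
  -- positive type at `a = conj ψ`
  have h2 : ∑ k, ∑ k', conj (ψ k) * conj (conj (ψ k')) * ((∫ x, c (T (k - k') x) * c x ∂μ : ℝ) : ℂ) =
      ((∫ x, ‖∑ k, conj (ψ k) * (c (T k x) : ℂ)‖ ^ 2 ∂μ : ℝ) : ℂ) :=
    sum_sum_twisted_coeff_eq_integral_norm_sq hK hC hT hT0 hTadd i fun k => conj (ψ k)
  -- `conj ψ(k) ψ(k') = conj ψ(k − k')`: the summand depends on `k − k'` only
  have h3 : ∀ k k' : Γ, conj (ψ k) * conj (conj (ψ k')) = conj (ψ (k - k')) := fun k k' => by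
    rw [Complex.conj_conj, ← AddChar.map_neg_eq_conj, ← AddChar.map_neg_eq_conj, neg_sub, sub_eq_add_neg,
      AddChar.map_add_eq_mul, mul_comm]
  have h4 : ∑ k, ∑ k', conj (ψ k) * conj (conj (ψ k')) * ((∫ x, c (T (k - k') x) * c x ∂μ : ℝ) : ℂ) =
      (Fintype.card Γ : ℂ) * ∑ d, conj (ψ d) * ((∫ x, c (T d x) * c x ∂μ : ℝ) : ℂ) := by
    have h5 : ∑ k, ∑ k', conj (ψ (k - k')) * ((∫ x, c (T (k - k') x) * c x ∂μ : ℝ) : ℂ) =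
        (Fintype.card Γ : ℂ) * ∑ d, conj (ψ d) * ((∫ x, c (T d x) * c x ∂μ : ℝ) : ℂ) :=
      sum_sum_sub_eq_card_mul fun d => conj (ψ d) * ((∫ x, c (T d x) * c x ∂μ : ℝ) : ℂ)
    rw [← h5]
    exact Finset.sum_congr rfl fun k _ => Finset.sum_congr rfl fun k' _ => by rw [h3]
  have h6 : ∑ d, conj (ψ d) * ((∫ x, c (T d x) * c x ∂μ : ℝ) : ℂ) =
      (Fintype.card Γ : ℂ)⁻¹ * ((∫ x, ‖∑ k, conj (ψ k) * (c (T k x) : ℂ)‖ ^ 2 ∂μ : ℝ) : ℂ) := by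
    rw [← h2, h4, ← mul_assoc, inv_mul_cancel₀ hcard, one_mul]
  rw [h6, ← mul_assoc]
  push_cast
  ring

/-- **The flux coefficients are non-negative reals**: `0 ≤ qᵢ(ψ)`, `Im qᵢ(ψ) = 0` (the weight of the eigenvector `κbᵢ`
in the flux sector `ψ`). [cite: tHooft1979Flux, §5 (5.1)–(5.2)] [cite: Serre1977, §2.6 Thm 8 (ii)] -/
theorem fluxCoeff_nonneg (hK : StronglyMeasurable (uncurry K))
    (hC : ∀ x y, ‖K x y‖ ≤ C) (hT : ∀ k, MeasurePreserving (T k) μ μ) (hT0 : T 0 = id)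
    (hTadd : ∀ k k' x, T (k + k') x = T k (T k' x)) (i : ι) (ψ : AddChar Γ ℂ) :
    0 ≤ ((Fintype.card Γ : ℂ)⁻¹ * ∑ k, conj (ψ k) *
        ((∫ x, (∫ z, K (T k x) z * b i z ∂μ) * (∫ z, K x z * b i z ∂μ) ∂μ : ℝ) : ℂ)).re ∧
      ((Fintype.card Γ : ℂ)⁻¹ * ∑ k, conj (ψ k) *
        ((∫ x, (∫ z, K (T k x) z * b i z ∂μ) * (∫ z, K x z * b i z ∂μ) ∂μ : ℝ) : ℂ)).im = 0 := by
  rw [fluxCoeff_eq_integral_norm_sq hK hC hT hT0 hTadd i ψ, Complex.ofReal_re, Complex.ofReal_im]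
  exact ⟨mul_nonneg (sq_nonneg _) (integral_nonneg fun x => sq_nonneg _), rfl⟩

/-- **Sum rule**: `Σ_ψ qᵢ(ψ) = gᵢ(0) = λᵢ²` — the sectors exhaust the eigenvector (`Σ_e P(e) = 1`) and
`∫ (κbᵢ)² = λᵢ²`. [cite: tHooft1979Flux, §5 (5.2)] [cite: ReedSimonI1980, Thm. VI.22–23] -/
theorem sum_fluxCoeff (hK : StronglyMeasurable (uncurry K)) (hC : ∀ x y, ‖K x y‖ ≤ C)
    (hA : ∀ φ : Lp ℝ 2 μ, (A φ : X → ℝ) =ᵐ[μ] fun x => ∫ y, K x y * φ y ∂μ)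
    (hb : ∀ i, A (b i) = lam i • b i) (hT0 : T 0 = id) (i : ι) :
    ∑ ψ : AddChar Γ ℂ, (Fintype.card Γ : ℂ)⁻¹ * ∑ k, conj (ψ k) *
        ((∫ x, (∫ z, K (T k x) z * b i z ∂μ) * (∫ z, K x z * b i z ∂μ) ∂μ : ℝ) : ℂ) =
      ((lam i ^ 2 : ℝ) : ℂ) := by
  rw [sum_fluxProjection_eq fun k =>
    ((∫ x, (∫ z, K (T k x) z * b i z ∂μ) * (∫ z, K x z * b i z ∂μ) ∂μ : ℝ) : ℂ)]
  rw [hT0, ← integral_sq_integral_kernel_mul_basis hK hC hA hb i]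
  simp only [id_eq]
  congr 1
  exact integral_congr_ae (Eventually.of_forall fun x => by ring)

/-- Each flux coefficient is at most the untwisted one: `qᵢ(ψ) ≤ λᵢ²` (the sum rule with non-negative summands).
[cite: tHooft1979Flux, §5 (5.2)] [cite: Serre1977, §2.6 Thm 8 (ii)] -/
theorem re_fluxCoeff_le (hK : StronglyMeasurable (uncurry K)) (hC : ∀ x y, ‖K x y‖ ≤ C)
    (hA : ∀ φ : Lp ℝ 2 μ, (A φ : X → ℝ) =ᵐ[μ] fun x => ∫ y, K x y * φ y ∂μ)
    (hb : ∀ i, A (b i) = lam i • b i) (hT : ∀ k, MeasurePreserving (T k) μ μ) (hT0 : T 0 = id)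
    (hTadd : ∀ k k' x, T (k + k') x = T k (T k' x)) (i : ι) (ψ : AddChar Γ ℂ) :
    ((Fintype.card Γ : ℂ)⁻¹ * ∑ k, conj (ψ k) *
        ((∫ x, (∫ z, K (T k x) z * b i z ∂μ) * (∫ z, K x z * b i z ∂μ) ∂μ : ℝ) : ℂ)).re ≤ lam i ^ 2 := by
  have hsum := congrArg Complex.re (sum_fluxCoeff (Γ := Γ) (T := T) hK hC hA hb hT0 i)
  rw [Complex.re_sum, Complex.ofReal_re] at hsum
  rw [← hsum]
  exact Finset.single_le_sum (fun ψ' _ => (fluxCoeff_nonneg hK hC hT hT0 hTadd i ψ').1) (Finset.mem_univ ψ)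

/-- **The vacuum carries no electric flux.**  If `K > 0` pointwise and `K` is invariant under every `T_k`, then at
the Perron–Frobenius top index `i₀` (`λ_{i₀} = ‖A‖ ≠ 0`) every twisted coefficient is `λ_{i₀}²`
(`integral_twisted_coeff_top`), so `q_{i₀}(ψ) = λ_{i₀}²` for the trivial character and `0` otherwise
(`Ω[k]|0⟩ = |0⟩`, i.e. `e = 0` in (4.3)/(4.5)). [cite: tHooft1979Flux, §4 (4.3)–(4.5)]
[cite: ReedSimonIV1978, Thm XIII.43 and Thm XIII.44] -/
theorem fluxCoeff_top (hK : StronglyMeasurable (uncurry K)) (hC : ∀ x y, ‖K x y‖ ≤ C)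
    (hsymm : ∀ x y, K x y = K y x) (hKpos : ∀ x y, 0 < K x y)
    (hA : ∀ φ : Lp ℝ 2 μ, (A φ : X → ℝ) =ᵐ[μ] fun x => ∫ y, K x y * φ y ∂μ)
    (hb : ∀ i, A (b i) = lam i • b i) (hT : ∀ k, MeasurePreserving (T k) μ μ)
    (hKT : ∀ k x y, K (T k x) (T k y) = K x y) {i₀ : ι} (hi₀ : lam i₀ = ‖A‖) (hlam₀ : lam i₀ ≠ 0)
    (ψ : AddChar Γ ℂ) :
    (Fintype.card Γ : ℂ)⁻¹ * ∑ k, conj (ψ k) *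
        ((∫ x, (∫ z, K (T k x) z * b i₀ z ∂μ) * (∫ z, K x z * b i₀ z ∂μ) ∂μ : ℝ) : ℂ) =
      if ψ = 0 then ((lam i₀ ^ 2 : ℝ) : ℂ) else 0 := by
  classical
  have hcard : (Fintype.card Γ : ℂ) ≠ 0 := Nat.cast_ne_zero.2 Fintype.card_ne_zero
  have htop : ∀ k, (∫ x, (∫ z, K (T k x) z * b i₀ z ∂μ) * (∫ z, K x z * b i₀ z ∂μ) ∂μ : ℝ) = lam i₀ ^ 2 :=
    fun k => integral_twisted_coeff_top hK hC hsymm hKpos hA hb (hT k) (hKT k) hi₀ hlam₀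
  simp_rw [htop]
  rw [← Finset.sum_mul, ← mul_assoc]
  have hs : ∑ k, conj (ψ k) = ∑ k, ψ k := by
    simp_rw [← AddChar.map_neg_eq_conj]
    exact Fintype.sum_equiv (Equiv.neg Γ) _ _ fun k => rfl
  rw [hs, AddChar.sum_eq_ite]
  split_ifs with h
  · rw [inv_mul_cancel₀ hcard, one_mul]
  · rw [mul_zero, zero_mul]

/-- **The flux-sector trace formula** ((5.3) expanded in the eigenbasis): for every character `ψ` and period
`M + 2`, `z_ψ(M+2) := |Γ|⁻¹ Σ_k conj ψ(k) z k (M+2) = Σᵢ λᵢ^M qᵢ(ψ)` whenever `z k (M+2)` are the twisted cyclic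
kernel integrals `∫ (κ^{[M+1]} K(·,x))(T_k x) dμ(x)` (`Tr(Ω[k] 𝕋^{M+2})`, the shape a twisted time-slicing theorem
delivers). [cite: tHooft1979Flux, §5 (5.1)–(5.3)] [cite: ReedSimonI1980, Thm. VI.22–23] -/
theorem hasSum_fluxSector [Countable ι] (hK : StronglyMeasurable (uncurry K)) (hC : ∀ x y, ‖K x y‖ ≤ C)
    (hsymm : ∀ x y, K x y = K y x)
    (hA : ∀ φ : Lp ℝ 2 μ, (A φ : X → ℝ) =ᵐ[μ] fun x => ∫ y, K x y * φ y ∂μ)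
    (hb : ∀ i, A (b i) = lam i • b i) (hT : ∀ k, MeasurePreserving (T k) μ μ) {z : Γ → ℕ → ℝ}
    (hz : ∀ k M, z k (M + 2) =
      ∫ x, ((fun f : X → ℝ => fun w => ∫ y, K w y * f y ∂μ)^[M + 1] (fun y => K y x)) (T k x) ∂μ)
    (ψ : AddChar Γ ℂ) (M : ℕ) :
    HasSum (fun i => ((lam i ^ M : ℝ) : ℂ) * ((Fintype.card Γ : ℂ)⁻¹ * ∑ k, conj (ψ k) *
        ((∫ x, (∫ z, K (T k x) z * b i z ∂μ) * (∫ z, K x z * b i z ∂μ) ∂μ : ℝ) : ℂ)))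
      ((Fintype.card Γ : ℂ)⁻¹ * ∑ k, conj (ψ k) * (z k (M + 2) : ℂ)) := by
  have hk : ∀ k, HasSum (fun i => ((lam i ^ M *
      ∫ x, (∫ z, K (T k x) z * b i z ∂μ) * (∫ z, K x z * b i z ∂μ) ∂μ : ℝ) : ℂ)) (z k (M + 2) : ℂ) :=
    fun k => by
    rw [hz k M]
    exact Complex.hasSum_ofReal.2 (hasSum_pow_integral_iterate_twisted hK hC hsymm hA hb (hT k).measurable M)
  have hsum := (hasSum_sum fun k (_ : k ∈ Finset.univ) => (hk k).mul_left (conj (ψ k))).mul_left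
    ((Fintype.card Γ : ℂ)⁻¹)
  have hfun : (fun i => ((lam i ^ M : ℝ) : ℂ) * ((Fintype.card Γ : ℂ)⁻¹ * ∑ k, conj (ψ k) *
      ((∫ x, (∫ z, K (T k x) z * b i z ∂μ) * (∫ z, K x z * b i z ∂μ) ∂μ : ℝ) : ℂ))) =
      fun i => (Fintype.card Γ : ℂ)⁻¹ * ∑ k, conj (ψ k) * ((lam i ^ M *
        ∫ x, (∫ z, K (T k x) z * b i z ∂μ) * (∫ z, K x z * b i z ∂μ) ∂μ : ℝ) : ℂ) := by
    funext i
    simp only [Finset.mul_sum]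
    push_cast
    exact Finset.sum_congr rfl fun k _ => by ring
  rw [hfun]
  exact hsum

/-- **Every flux sector is non-negative and real** — 't Hooft's `e^{−βF(e)} = Tr P(e) e^{−βH} ≥ 0`, on the lattice a
THEOREM about the Fourier transform (5.4) of the twisted partition functions, for non-negative eigenvalues (a positive
transfer operator) and every period `M + 2`: `0 ≤ z_ψ(M+2)` and `Im z_ψ(M+2) = 0`.
[cite: tHooft1979Flux, §5 (5.1)–(5.4)] -/
theorem fluxSector_nonneg [Countable ι] (hK : StronglyMeasurable (uncurry K)) (hC : ∀ x y, ‖K x y‖ ≤ C)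
    (hsymm : ∀ x y, K x y = K y x)
    (hA : ∀ φ : Lp ℝ 2 μ, (A φ : X → ℝ) =ᵐ[μ] fun x => ∫ y, K x y * φ y ∂μ)
    (hb : ∀ i, A (b i) = lam i • b i) (hlam : ∀ i, 0 ≤ lam i) (hT : ∀ k, MeasurePreserving (T k) μ μ)
    (hT0 : T 0 = id) (hTadd : ∀ k k' x, T (k + k') x = T k (T k' x)) {z : Γ → ℕ → ℝ}
    (hz : ∀ k M, z k (M + 2) =
      ∫ x, ((fun f : X → ℝ => fun w => ∫ y, K w y * f y ∂μ)^[M + 1] (fun y => K y x)) (T k x) ∂μ)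
    (ψ : AddChar Γ ℂ) (M : ℕ) :
    0 ≤ ((Fintype.card Γ : ℂ)⁻¹ * ∑ k, conj (ψ k) * (z k (M + 2) : ℂ)).re ∧
      ((Fintype.card Γ : ℂ)⁻¹ * ∑ k, conj (ψ k) * (z k (M + 2) : ℂ)).im = 0 := by
  have h := hasSum_fluxSector hK hC hsymm hA hb hT hz ψ M
  have hq := fun i : ι => fluxCoeff_nonneg (b := b) hK hC hT hT0 hTadd i ψ
  have hre : ∀ i, 0 ≤ (((lam i ^ M : ℝ) : ℂ) * ((Fintype.card Γ : ℂ)⁻¹ * ∑ k, conj (ψ k) *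
      ((∫ x, (∫ z, K (T k x) z * b i z ∂μ) * (∫ z, K x z * b i z ∂μ) ∂μ : ℝ) : ℂ))).re := fun i => by
    rw [Complex.re_ofReal_mul]
    exact mul_nonneg (pow_nonneg (hlam i) M) (hq i).1
  have him : ∀ i, (((lam i ^ M : ℝ) : ℂ) * ((Fintype.card Γ : ℂ)⁻¹ * ∑ k, conj (ψ k) *
      ((∫ x, (∫ z, K (T k x) z * b i z ∂μ) * (∫ z, K x z * b i z ∂μ) ∂μ : ℝ) : ℂ))).im = 0 := fun i => by
    rw [Complex.im_ofReal_mul, (hq i).2, mul_zero]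
  refine ⟨(Complex.hasSum_re h).nonneg hre, ?_⟩
  have hi := Complex.hasSum_im h
  have h0 : (fun i => (((lam i ^ M : ℝ) : ℂ) * ((Fintype.card Γ : ℂ)⁻¹ * ∑ k, conj (ψ k) *
      ((∫ x, (∫ z, K (T k x) z * b i z ∂μ) * (∫ z, K x z * b i z ∂μ) ∂μ : ℝ) : ℂ))).im) = fun _ => 0 :=
    funext him
  rw [h0] at hi
  exact hi.unique hasSum_zero

/-- **Completeness of the sectors**: `Σ_ψ z_ψ(n) = z 0 n` — the flux sectors add up to the untwisted trace
(for `n = M + 2` and `T 0 = id` this is the partition function `Tr 𝕋^{M+2}`); pure character orthogonality, valid for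
any family `z`. [cite: tHooft1979Flux, §5 (5.2)–(5.4)] [cite: Serre1977, §2.6 Thm 8 (ii)] -/
theorem sum_fluxSector (z : Γ → ℕ → ℝ) (n : ℕ) :
    ∑ ψ : AddChar Γ ℂ, (Fintype.card Γ : ℂ)⁻¹ * ∑ k, conj (ψ k) * (z k n : ℂ) = (z 0 n : ℂ) :=
  sum_fluxProjection_eq fun k => (z k n : ℂ)

/-- **Inversion**: `z k n = Σ_ψ ψ(k) z_ψ(n)` — each twisted trace is the character-weighted sum of the flux
sectors (inverting (5.3): `Tr Ω[k] e^{−βH} = Σ_e e^{2πi(k·e)/N} e^{−βF(e)}`). [cite: tHooft1979Flux, §5 (5.3)]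
[cite: Serre1977, §2.3 Thm 3 and §2.6 Thm 8 (ii)] -/
theorem sum_apply_mul_fluxSector (z : Γ → ℕ → ℝ) (n : ℕ) (k₀ : Γ) :
    ∑ ψ : AddChar Γ ℂ, ψ k₀ * ((Fintype.card Γ : ℂ)⁻¹ * ∑ k, conj (ψ k) * (z k n : ℂ)) = (z k₀ n : ℂ) :=
  sum_apply_mul_fluxProjection_eq (fun k => (z k n : ℂ)) k₀

/-- **Each sector is dominated by the total**: `z_ψ(M+2) ≤ z 0 (M+2)` — with the normalisation `z 0 = Z` this is
`0 ≤ e^{−βF(e)} ≤ 1`, the flux-projected refinement of the Tomboulis–Yaffe ∕ Kanazawa bound `Z^{[k]} ≤ Z`.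
[cite: tHooft1979Flux, §5 (5.4)] [cite: Kanazawa2008, §2 Lemma 2 eq. (17)–(18)] -/
theorem re_fluxSector_le [Countable ι] (hK : StronglyMeasurable (uncurry K)) (hC : ∀ x y, ‖K x y‖ ≤ C)
    (hsymm : ∀ x y, K x y = K y x)
    (hA : ∀ φ : Lp ℝ 2 μ, (A φ : X → ℝ) =ᵐ[μ] fun x => ∫ y, K x y * φ y ∂μ)
    (hb : ∀ i, A (b i) = lam i • b i) (hlam : ∀ i, 0 ≤ lam i) (hT : ∀ k, MeasurePreserving (T k) μ μ)
    (hT0 : T 0 = id) (hTadd : ∀ k k' x, T (k + k') x = T k (T k' x)) {z : Γ → ℕ → ℝ}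
    (hz : ∀ k M, z k (M + 2) =
      ∫ x, ((fun f : X → ℝ => fun w => ∫ y, K w y * f y ∂μ)^[M + 1] (fun y => K y x)) (T k x) ∂μ)
    (ψ : AddChar Γ ℂ) (M : ℕ) :
    ((Fintype.card Γ : ℂ)⁻¹ * ∑ k, conj (ψ k) * (z k (M + 2) : ℂ)).re ≤ z 0 (M + 2) := by
  have hsum := congrArg Complex.re (sum_fluxSector (Γ := Γ) z (M + 2))
  rw [Complex.re_sum, Complex.ofReal_re] at hsum
  rw [← hsum]
  exact Finset.single_le_sum
    (fun ψ' _ => (fluxSector_nonneg hK hC hsymm hA hb hlam hT hT0 hTadd hz ψ' M).1) (Finset.mem_univ ψ)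

/-- **The flux-free sector carries the vacuum**: `λ_{i₀}^M · λ_{i₀}² ≤ z_0(M+2)` for the trivial character
(`K > 0` invariant, top index `i₀`, non-negative eigenvalues). [cite: tHooft1979Flux, §4 (4.3)–(4.5) and §5 (5.3)]
[cite: ReedSimonIV1978, Thm XIII.43 and Thm XIII.44] -/
theorem le_re_fluxSector_zero [Countable ι] (hK : StronglyMeasurable (uncurry K)) (hC : ∀ x y, ‖K x y‖ ≤ C)
    (hsymm : ∀ x y, K x y = K y x) (hKpos : ∀ x y, 0 < K x y)
    (hA : ∀ φ : Lp ℝ 2 μ, (A φ : X → ℝ) =ᵐ[μ] fun x => ∫ y, K x y * φ y ∂μ)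
    (hb : ∀ i, A (b i) = lam i • b i) (hlam : ∀ i, 0 ≤ lam i) {i₀ : ι} (hi₀ : lam i₀ = ‖A‖)
    (hlam₀ : lam i₀ ≠ 0) (hT : ∀ k, MeasurePreserving (T k) μ μ) (hT0 : T 0 = id)
    (hTadd : ∀ k k' x, T (k + k') x = T k (T k' x)) (hKT : ∀ k x y, K (T k x) (T k y) = K x y)
    {z : Γ → ℕ → ℝ}
    (hz : ∀ k M, z k (M + 2) =
      ∫ x, ((fun f : X → ℝ => fun w => ∫ y, K w y * f y ∂μ)^[M + 1] (fun y => K y x)) (T k x) ∂μ)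
    (M : ℕ) :
    lam i₀ ^ M * lam i₀ ^ 2 ≤
      ((Fintype.card Γ : ℂ)⁻¹ * ∑ k, conj ((0 : AddChar Γ ℂ) k) * (z k (M + 2) : ℂ)).re := by
  classical
  have h := Complex.hasSum_re (hasSum_fluxSector hK hC hsymm hA hb hT hz 0 M)
  have hq := fun i : ι => fluxCoeff_nonneg (b := b) hK hC hT hT0 hTadd i (0 : AddChar Γ ℂ)
  have htop := fluxCoeff_top hK hC hsymm hKpos hA hb hT hKT hi₀ hlam₀ (0 : AddChar Γ ℂ)
  rw [if_pos rfl] at htop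
  have hterm : ∀ j, 0 ≤ (((lam j ^ M : ℝ) : ℂ) * ((Fintype.card Γ : ℂ)⁻¹ * ∑ k, conj ((0 : AddChar Γ ℂ) k) *
      ((∫ x, (∫ z, K (T k x) z * b j z ∂μ) * (∫ z, K x z * b j z ∂μ) ∂μ : ℝ) : ℂ))).re := fun j => by
    rw [Complex.re_ofReal_mul]
    exact mul_nonneg (pow_nonneg (hlam j) M) (hq j).1
  calc lam i₀ ^ M * lam i₀ ^ 2
      = (((lam i₀ ^ M : ℝ) : ℂ) * ((Fintype.card Γ : ℂ)⁻¹ * ∑ k, conj ((0 : AddChar Γ ℂ) k) *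
          ((∫ x, (∫ z, K (T k x) z * b i₀ z ∂μ) * (∫ z, K x z * b i₀ z ∂μ) ∂μ : ℝ) : ℂ))).re := by
        rw [htop, ← Complex.ofReal_mul, Complex.ofReal_re]
    _ ≤ _ := le_hasSum h i₀ fun j _ => hterm j

/-- **The energy of a non-zero electric flux is at least the finite-volume gap.**  If every sub-dominant eigenvalue
is `≤ Λ` (`λᵢ ≤ Λ` for `i ≠ i₀`), then for every character `ψ ≠ 0`: `z_ψ(M+2) ≤ Λ^M · z_ψ(2)` — the vacuum has no
component in the sector `ψ` (`fluxCoeff_top`), so only eigenvalues `≤ Λ` propagate; in 't Hooft's words ((5.4) ff.)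
«in the limit β → ∞, F becomes the energy of the lowest state with the given flux», and that energy is at least
`−log(Λ/λ_{i₀})` per unit time above the vacuum. [cite: tHooft1979Flux, §5 (5.3)–(5.4)]
[cite: ReedSimonIV1978, Thm XIII.43 and Thm XIII.44] -/
theorem re_fluxSector_le_pow_mul [Countable ι] (hK : StronglyMeasurable (uncurry K)) (hC : ∀ x y, ‖K x y‖ ≤ C)
    (hsymm : ∀ x y, K x y = K y x) (hKpos : ∀ x y, 0 < K x y)
    (hA : ∀ φ : Lp ℝ 2 μ, (A φ : X → ℝ) =ᵐ[μ] fun x => ∫ y, K x y * φ y ∂μ)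
    (hb : ∀ i, A (b i) = lam i • b i) (hlam : ∀ i, 0 ≤ lam i) {i₀ : ι} (hi₀ : lam i₀ = ‖A‖)
    (hlam₀ : lam i₀ ≠ 0) {Λ : ℝ} (hΛ : ∀ i, i ≠ i₀ → lam i ≤ Λ) (hT : ∀ k, MeasurePreserving (T k) μ μ)
    (hT0 : T 0 = id) (hTadd : ∀ k k' x, T (k + k') x = T k (T k' x))
    (hKT : ∀ k x y, K (T k x) (T k y) = K x y) {z : Γ → ℕ → ℝ}
    (hz : ∀ k M, z k (M + 2) =
      ∫ x, ((fun f : X → ℝ => fun w => ∫ y, K w y * f y ∂μ)^[M + 1] (fun y => K y x)) (T k x) ∂μ)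
    {ψ : AddChar Γ ℂ} (hψ : ψ ≠ 0) (M : ℕ) :
    ((Fintype.card Γ : ℂ)⁻¹ * ∑ k, conj (ψ k) * (z k (M + 2) : ℂ)).re ≤
      Λ ^ M * ((Fintype.card Γ : ℂ)⁻¹ * ∑ k, conj (ψ k) * (z k 2 : ℂ)).re := by
  classical
  have hM := Complex.hasSum_re (hasSum_fluxSector hK hC hsymm hA hb hT hz ψ M)
  have h0 := (Complex.hasSum_re (hasSum_fluxSector hK hC hsymm hA hb hT hz ψ 0)).mul_left (Λ ^ M)
  have hq := fun i : ι => fluxCoeff_nonneg (b := b) hK hC hT hT0 hTadd i ψ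
  have htop := fluxCoeff_top hK hC hsymm hKpos hA hb hT hKT hi₀ hlam₀ ψ
  rw [if_neg hψ] at htop
  have hpt : ∀ i, (((lam i ^ M : ℝ) : ℂ) * ((Fintype.card Γ : ℂ)⁻¹ * ∑ k, conj (ψ k) *
      ((∫ x, (∫ z, K (T k x) z * b i z ∂μ) * (∫ z, K x z * b i z ∂μ) ∂μ : ℝ) : ℂ))).re ≤
      Λ ^ M * (((lam i ^ 0 : ℝ) : ℂ) * ((Fintype.card Γ : ℂ)⁻¹ * ∑ k, conj (ψ k) *
      ((∫ x, (∫ z, K (T k x) z * b i z ∂μ) * (∫ z, K x z * b i z ∂μ) ∂μ : ℝ) : ℂ))).re := fun i => by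
    rw [Complex.re_ofReal_mul, Complex.re_ofReal_mul, pow_zero, one_mul]
    by_cases hi : i = i₀
    · subst hi
      rw [htop, Complex.zero_re, mul_zero, mul_zero]
    · exact mul_le_mul_of_nonneg_right (pow_le_pow_left₀ (hlam i) (hΛ i hi) M) (hq i).1
  exact hasSum_le hpt hM h0

/-- **Flux sectors live in the excited spectrum**: for `ψ ≠ 0`, `z_ψ(2) ≤ z 0 2 − λ_{i₀}²` (the vacuum term
`λ_{i₀}²` sits entirely in the flux-free sector, and all sectors are non-negative).
[cite: tHooft1979Flux, §4 (4.3)–(4.5) and §5 (5.3)–(5.4)] [cite: ReedSimonIV1978, Thm XIII.43 and Thm XIII.44] -/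
theorem re_fluxSector_le_sub [Countable ι] (hK : StronglyMeasurable (uncurry K)) (hC : ∀ x y, ‖K x y‖ ≤ C)
    (hsymm : ∀ x y, K x y = K y x) (hKpos : ∀ x y, 0 < K x y)
    (hA : ∀ φ : Lp ℝ 2 μ, (A φ : X → ℝ) =ᵐ[μ] fun x => ∫ y, K x y * φ y ∂μ)
    (hb : ∀ i, A (b i) = lam i • b i) (hlam : ∀ i, 0 ≤ lam i) {i₀ : ι} (hi₀ : lam i₀ = ‖A‖)
    (hlam₀ : lam i₀ ≠ 0) (hT : ∀ k, MeasurePreserving (T k) μ μ) (hT0 : T 0 = id)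
    (hTadd : ∀ k k' x, T (k + k') x = T k (T k' x)) (hKT : ∀ k x y, K (T k x) (T k y) = K x y)
    {z : Γ → ℕ → ℝ}
    (hz : ∀ k M, z k (M + 2) =
      ∫ x, ((fun f : X → ℝ => fun w => ∫ y, K w y * f y ∂μ)^[M + 1] (fun y => K y x)) (T k x) ∂μ)
    {ψ : AddChar Γ ℂ} (hψ : ψ ≠ 0) :
    ((Fintype.card Γ : ℂ)⁻¹ * ∑ k, conj (ψ k) * (z k 2 : ℂ)).re ≤ z 0 2 - lam i₀ ^ 2 := by
  classical
  -- all sectors are `≥ 0`, they sum to `z 0 2`, and the flux-free one is `≥ λ_{i₀}²`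
  have hsum := congrArg Complex.re (sum_fluxSector (Γ := Γ) z 2)
  rw [Complex.re_sum, Complex.ofReal_re] at hsum
  have hnn := fun ψ' => (fluxSector_nonneg hK hC hsymm hA hb hlam hT hT0 hTadd hz ψ' 0).1
  have hvac := le_re_fluxSector_zero hK hC hsymm hKpos hA hb hlam hi₀ hlam₀ hT hT0 hTadd hKT hz 0
  rw [pow_zero, one_mul] at hvac
  have hpair : ∑ χ ∈ ({ψ, 0} : Finset (AddChar Γ ℂ)), ((Fintype.card Γ : ℂ)⁻¹ * ∑ k, conj (χ k) * (z k 2 : ℂ)).re =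
      ((Fintype.card Γ : ℂ)⁻¹ * ∑ k, conj (ψ k) * (z k 2 : ℂ)).re +
        ((Fintype.card Γ : ℂ)⁻¹ * ∑ k, conj ((0 : AddChar Γ ℂ) k) * (z k 2 : ℂ)).re :=
    Finset.sum_pair hψ
  have h2 : ((Fintype.card Γ : ℂ)⁻¹ * ∑ k, conj (ψ k) * (z k 2 : ℂ)).re +
      ((Fintype.card Γ : ℂ)⁻¹ * ∑ k, conj ((0 : AddChar Γ ℂ) k) * (z k 2 : ℂ)).re ≤ z 0 2 := by
    rw [← hsum, ← hpair]
    exact Finset.sum_le_sum_of_subset_of_nonneg (Finset.subset_univ _) fun ψ' _ _ => hnn ψ'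
  linarith

end Kernel

end Literature.Analysis.OperatorTheory

end
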